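import Summits.BirchSwinnertonDyer.BirchSwinnertonDyer.Theorems.KatoDescentPotSupersingularCartanMuRoadRealClassNumberDoors
import Summits.BirchSwinnertonDyer.BirchSwinnertonDyer.Theorems.KatoDescentPotSupersingularWildConjAResidueCartanRowsNnImg03
import Summits.BirchSwinnertonDyer.BirchSwinnertonDyer.Theorems.KatoDescentPotSupersingularWildConjAResidueCartanRowsNnImg04
import HarnessLib

/-!
# Route `KatoDescentPotSupersingular` (rung K9, sub-rung B5 = O6 wild `p = 3`, cell `bsd-potss`): the `3Nn` RESIDUE ROWS of the Conj-A crux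
# `WildCoatesSujathaResidue` (19942; node 19189 → parent 19197) whose maximal real subfield `K⁺ = ℚ(E[3])⁺` passes IWASAWA'S 1956
# CRITERION (`3 ∤ h(K⁺)`, one prime above `3`): (A) / U₀ per row from NAMED FACTS + two displayed numerical facts (part 03: 390285r1, 443205bc1, 487350gz1)
# (seat `bsd-potss-k9-c4` g18; `--supports stmt-BirchSwinnertonDyer-19197 --as helper`)

HONEST FRAMING. THEOREMS ONLY (no definition, no named fact, no `sorry`); PER ROW; nothing is booked; items 19942 / 19189 / 19197 stay OPEN
at class level; (A), Conjecture A and BSD are proved for NO curve.  The Cartan μ-road records (`…WildConjAResidueCartanRows*`, `…NnImg*`, this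
seat) display `hμ : μ = 0 for the cyclotomic ℤ_3-extension of K⁺`, `K⁺` = the fixed field of a complex conjugation in `ℚ(E[3])` (= `ℚ(P)`,
`P` a real `3`-torsion point; degree `8` on `3Nn` rows).  This seat's doors `CartanMuRoadRealDoors.…_of_realClassNumber` (p630180) feed `hμ`
by the NAMED FACT `iwasawa1956_classNumberPExp_eq_zero_of_not_dvd_classNumber_of_unique_prime` (Iwasawa 1956 / Greenberg Prop. 2.1): it
suffices that `3 ∤ h(K⁺)` and that `K⁺` has exactly one prime above `3`.  NUMERICS (PARI/GP 2.17, kit j307532, `--workitem 19197`; GRH-free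
`bnfcertify` j307547): on 11 of the 12 `3Nn` residue rows `K⁺` is one of four octic fields with `h ∈ {{1, 4}}` and `3𝓞_{{K⁺}} = 𝔭⁸`
(the exception `406593q1` has five primes above `3`); on the 11 `3Ns` rows `3` splits in the quartic `K⁺` (no Iwasawa-1956 door; the Fukuda
layer doors of conjA-anchor g8/g9 remain the numerics of record there).  So on these 11 rows every displayed input of the U₀ record is a
NAMED published theorem, Cremona's `r_an = 0`, or a finite numerical fact about ONE explicit octic number field (class number, splitting
of `3`).  The identification of the Lean field `fixedField (zpowers c|ℚ(E[3]))` with `ℚ[x]/(f₈)` is the memo's (HOME/k9-c4/g18/FINDING §5: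
`[ℚ(E[3]) : K⁺] = 2 = #Stab(P)`, `P` real), not a kernel statement.

References: [Iwasawa1956]; [Greenberg2001IwasawaPastPresent] Prop. 2.1; [CoatesSujatha2005] Thm. 3.4; [Kato2004Asterisque] Thm. 14.5 (3);
[Serre1972] §2.2, §5.2; [Washington1997] §13.1; [Cremona2006] Table 1.
-/

set_option autoImplicit false
set_option linter.dupNamespace false

noncomputable section

open scoped Classical NumberField
open Polynomial WeierstrassCurve NumberField IsDedekindDomain IsDedekindDomain.HeightOneSpectrum Rat.HeightOneSpectrum Field IntermediateField
  Literature.NumberTheory.DiophantineGeometry Literature.NumberTheory.EllipticCurves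
  Literature.NumberTheory.EllipticCurves.ModularForms Literature.NumberTheory.EllipticCurves.Rank1Residual
  Literature.NumberTheory.EllipticCurves.Rank1Residual.Typed Literature.NumberTheory.Automorphic
  Literature.NumberTheory.EllipticCurves.Rank1Residual.X11RankOneCertificates
  Literature.NumberTheory.GaloisRepresentations Literature.NumberTheory.SerreUniformity Literature.NumberTheory.IwasawaTheory
  Summit.BirchSwinnertonDyer.BirchSwinnertonDyer.Rank1Residual.IntModel
  Summit.BirchSwinnertonDyer.Rank1Residual Summit.BirchSwinnertonDyer.Rank1Residual.Additive
  Summit.BirchSwinnertonDyer.Rank1Residual.X11b Summit.BirchSwinnertonDyer.Rank1Residual.Supersingular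
  Summit.BirchSwinnertonDyer.BirchSwinnertonDyer.Rank2Observatory.RootNumber
  Summit.BirchSwinnertonDyer.BirchSwinnertonDyer.Theorems
  Summit.BirchSwinnertonDyer.BirchSwinnertonDyer.Theorems.TameUpperUnitTwistRecords

namespace Summit.BirchSwinnertonDyer.BirchSwinnertonDyer.Theorems.WildUpperUnitTwistRecords

/-! ### `390285r1` — `K⁺ = ℚ(E[3])⁺ ≅ ℚ[x]/(x^8 - 3*x^7 - 3*x^6 + 12*x^5 - 6*x^3 - 6*x^2 + 3*x - 3)` (degree 8, disc -257298363), `h(K⁺) = 1`, `3𝓞 = 𝔭⁸` (PARI/GP 2.17, kit j307532; `bnfcertify` j307547) -/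

/-- **(A) AT `(390285r1, 3)` FROM NAMED FACTS + TWO NUMERICAL FACTS ABOUT `K⁺ = ℚ(E[3])⁺`** (Iwasawa's 1956 criterion): image `3Nn` in the
kernel (`hasModPImageEqNonsplitCartanNormalizer_g390285r1_3`); named facts Coates–Sujatha Thm. 3.4 (`hCS`), Iwasawa growth (`hI`), Ferrero–Washington
(`hFW`), Iwasawa 1956 (`hIw`); DISPLAYED: `3 ∤ h(K⁺)` (`hh`) and «exactly one prime of `K⁺` above `3`» (`hv`) for the maximal real subfield
`K⁺` of `ℚ(E[3])` (the fixed field of a complex conjugation `c`) — numerically `K⁺ ≅ ℚ[x]/(x^8 - 3*x^7 - 3*x^6 + 12*x^5 - 6*x^3 - 6*x^2 + 3*x - 3)`, `h = 1`, `3` totally ramified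
(PARI, kit j307532 / j307547; the identification `K⁺ = ℚ(P)`, `P` a real `3`-torsion point, is this seat's memo §5, not a kernel statement).
CONDITIONAL; nothing booked; (A)/BSD proved for no curve. [cite: Greenberg2001IwasawaPastPresent, Prop. 2.1 p. 339] [cite: CoatesSujatha2005, Thm. 3.4 (§3)]
[cite: Serre1972, §2.2, §5.2 (iv)] [cite: Cremona2006, Table 1 (Cremona label 390285r1)] -/
theorem conjA_g390285r1_3_iw
    (hCS : CoatesSujatha2005.thm34_fineSelmerDual_moduleFinite_of_classicalMuVanishes_divisionField)
    (hI : iwasawa1959_classNumberPExp_growth) (hFW : ferreroWashington1979_classicalMuVanishes)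
    (hIw : iwasawa1956_classNumberPExp_eq_zero_of_not_dvd_classNumber_of_unique_prime)
    {W : WeierstrassCurve ℚ} [W.IsElliptic] (hWeq : W = (⟨1, (-1), 0, (-777345), 341939996⟩ : WeierstrassCurve ℚ))
    {c : absoluteGaloisGroup ℚ} (hc : IsComplexConjugation (Rat.castHom ℝ) c)
    (hh : haveI : NumberField ↥(W.divisionField 3) := NumberField.mk
      ¬ 3 ∣ NumberField.classNumber ↥(fixedField (Subgroup.zpowers (absRestrictNormalHom (W.divisionField 3) c))))
    (hv : haveI : NumberField ↥(W.divisionField 3) := NumberField.mk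
      ∃! v : IsDedekindDomain.HeightOneSpectrum (𝓞 ↥(fixedField (Subgroup.zpowers (absRestrictNormalHom (W.divisionField 3) c)))),
        ((3 : ℕ) : 𝓞 ↥(fixedField (Subgroup.zpowers (absRestrictNormalHom (W.divisionField 3) c)))) ∈ v.asIdeal)
    (κ : ZpExtension ℚ 3) (hκ : κ.IsCyclotomic) :
    ∃ (γ : absoluteGaloisGroup ℚ) (Df : W.FineSelmerDualData κ γ),
      Module.Finite ℤ_[3] (RestrictScalars ℤ_[3] (IwasawaAlgebra 3) Df.X) := by
  subst hWeq
  exact CartanMuRoadRealDoors.conjA_three_of_hasModPImageEqNonsplitCartanNormalizer_of_realClassNumber _ hCS hI hFW hIw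
    hasModPImageEqNonsplitCartanNormalizer_g390285r1_3 hc hh hv κ hκ

/-- **RECORD — U₀ `ord₃ #Ш(E) ≤ ord₃ #Ш_an(E)` for `E = 390285r1` FROM NAMED FACTS + Cremona's `r_an = 0` + TWO NUMERICAL FACTS ABOUT `K⁺`**:
named facts `hKatoA hGZK hmod hCS hI hFW hIw`; DISPLAYED: `hr`, `hh : 3 ∤ h(K⁺)`, `hv : one prime of K⁺ above 3` (`K⁺ ≅ ℚ[x]/(x^8 - 3*x^7 - 3*x^6 + 12*x^5 - 6*x^3 - 6*x^2 + 3*x - 3)`,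
`h = 1`, `3𝓞 = 𝔭⁸`; PARI j307532/j307547). KERNEL: elliptic, minimal, `ClassO6 E 3`, `E[3]` irreducible, image `= C_ns⁺(3)`, `c² = 1`,
`c ≠ ±1`. Per row; nothing booked; BSD proved for no curve. [cite: Kato2004Asterisque, Thm. 14.5 (3) (p. 236)]
[cite: Greenberg2001IwasawaPastPresent, Prop. 2.1 p. 339] [cite: CoatesSujatha2005, Thm. 3.4 (§3)] [cite: Cremona2006, Table 1 (Cremona label 390285r1)] -/
theorem missingUpperBoundAt_g390285r1_3_iw
    (hKatoA : Kato2004.rankZero_padicValNat_sha_add_padicValNat_tamagawa_le_of_additive_potGood_of_irreducible_of_fineSelmerDual_fg)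
    (hGZK : rank_eq_analyticRank_of_analyticRank_le_one) (hmod : hasEntireLFunction_rat)
    (hCS : CoatesSujatha2005.thm34_fineSelmerDual_moduleFinite_of_classicalMuVanishes_divisionField)
    (hI : iwasawa1959_classNumberPExp_growth) (hFW : ferreroWashington1979_classicalMuVanishes)
    (hIw : iwasawa1956_classNumberPExp_eq_zero_of_not_dvd_classNumber_of_unique_prime)
    {W : WeierstrassCurve ℚ} [W.IsElliptic] [W.IsGloballyMinimal] (hWeq : W = (⟨1, (-1), 0, (-777345), 341939996⟩ : WeierstrassCurve ℚ)) (hr : W.analyticRank = 0)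
    {c : absoluteGaloisGroup ℚ} (hc : IsComplexConjugation (Rat.castHom ℝ) c)
    (hh : haveI : NumberField ↥(W.divisionField 3) := NumberField.mk
      ¬ 3 ∣ NumberField.classNumber ↥(fixedField (Subgroup.zpowers (absRestrictNormalHom (W.divisionField 3) c))))
    (hv : haveI : NumberField ↥(W.divisionField 3) := NumberField.mk
      ∃! v : IsDedekindDomain.HeightOneSpectrum (𝓞 ↥(fixedField (Subgroup.zpowers (absRestrictNormalHom (W.divisionField 3) c)))),
        ((3 : ℕ) : 𝓞 ↥(fixedField (Subgroup.zpowers (absRestrictNormalHom (W.divisionField 3) c)))) ∈ v.asIdeal) :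
    MissingUpperBoundAt W 3 := by
  subst hWeq
  exact CartanMuRoadRealDoors.missingUpperBoundAt_three_of_hasModPImageEqNonsplitCartanNormalizer_of_realClassNumber _ hKatoA hGZK hmod
    hCS hI hFW hIw hr classO6_g390285r1_3 irr_g390285r1_3 hasModPImageEqNonsplitCartanNormalizer_g390285r1_3 hc hh hv

/-! ### `443205bc1` — `K⁺ = ℚ(E[3])⁺ ≅ ℚ[x]/(x^8 - 3*x^7 - 3*x^6 + 12*x^5 - 6*x^3 - 6*x^2 + 3*x - 3)` (degree 8, disc -257298363), `h(K⁺) = 1`, `3𝓞 = 𝔭⁸` (PARI/GP 2.17, kit j307532; `bnfcertify` j307547) -/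

/-- **(A) AT `(443205bc1, 3)` FROM NAMED FACTS + TWO NUMERICAL FACTS ABOUT `K⁺ = ℚ(E[3])⁺`** (Iwasawa's 1956 criterion): image `3Nn` in the
kernel (`hasModPImageEqNonsplitCartanNormalizer_g443205bc1_3`); named facts Coates–Sujatha Thm. 3.4 (`hCS`), Iwasawa growth (`hI`), Ferrero–Washington
(`hFW`), Iwasawa 1956 (`hIw`); DISPLAYED: `3 ∤ h(K⁺)` (`hh`) and «exactly one prime of `K⁺` above `3`» (`hv`) for the maximal real subfield
`K⁺` of `ℚ(E[3])` (the fixed field of a complex conjugation `c`) — numerically `K⁺ ≅ ℚ[x]/(x^8 - 3*x^7 - 3*x^6 + 12*x^5 - 6*x^3 - 6*x^2 + 3*x - 3)`, `h = 1`, `3` totally ramified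
(PARI, kit j307532 / j307547; the identification `K⁺ = ℚ(P)`, `P` a real `3`-torsion point, is this seat's memo §5, not a kernel statement).
CONDITIONAL; nothing booked; (A)/BSD proved for no curve. [cite: Greenberg2001IwasawaPastPresent, Prop. 2.1 p. 339] [cite: CoatesSujatha2005, Thm. 3.4 (§3)]
[cite: Serre1972, §2.2, §5.2 (iv)] [cite: Cremona2006, Table 1 (Cremona label 443205bc1)] -/
theorem conjA_g443205bc1_3_iw
    (hCS : CoatesSujatha2005.thm34_fineSelmerDual_moduleFinite_of_classicalMuVanishes_divisionField)
    (hI : iwasawa1959_classNumberPExp_growth) (hFW : ferreroWashington1979_classicalMuVanishes)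
    (hIw : iwasawa1956_classNumberPExp_eq_zero_of_not_dvd_classNumber_of_unique_prime)
    {W : WeierstrassCurve ℚ} [W.IsElliptic] (hWeq : W = (⟨1, (-1), 0, (-1601574), (-822843757)⟩ : WeierstrassCurve ℚ))
    {c : absoluteGaloisGroup ℚ} (hc : IsComplexConjugation (Rat.castHom ℝ) c)
    (hh : haveI : NumberField ↥(W.divisionField 3) := NumberField.mk
      ¬ 3 ∣ NumberField.classNumber ↥(fixedField (Subgroup.zpowers (absRestrictNormalHom (W.divisionField 3) c))))
    (hv : haveI : NumberField ↥(W.divisionField 3) := NumberField.mk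
      ∃! v : IsDedekindDomain.HeightOneSpectrum (𝓞 ↥(fixedField (Subgroup.zpowers (absRestrictNormalHom (W.divisionField 3) c)))),
        ((3 : ℕ) : 𝓞 ↥(fixedField (Subgroup.zpowers (absRestrictNormalHom (W.divisionField 3) c)))) ∈ v.asIdeal)
    (κ : ZpExtension ℚ 3) (hκ : κ.IsCyclotomic) :
    ∃ (γ : absoluteGaloisGroup ℚ) (Df : W.FineSelmerDualData κ γ),
      Module.Finite ℤ_[3] (RestrictScalars ℤ_[3] (IwasawaAlgebra 3) Df.X) := by
  subst hWeq
  exact CartanMuRoadRealDoors.conjA_three_of_hasModPImageEqNonsplitCartanNormalizer_of_realClassNumber _ hCS hI hFW hIw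
    hasModPImageEqNonsplitCartanNormalizer_g443205bc1_3 hc hh hv κ hκ

/-- **RECORD — U₀ `ord₃ #Ш(E) ≤ ord₃ #Ш_an(E)` for `E = 443205bc1` FROM NAMED FACTS + Cremona's `r_an = 0` + TWO NUMERICAL FACTS ABOUT `K⁺`**:
named facts `hKatoA hGZK hmod hCS hI hFW hIw`; DISPLAYED: `hr`, `hh : 3 ∤ h(K⁺)`, `hv : one prime of K⁺ above 3` (`K⁺ ≅ ℚ[x]/(x^8 - 3*x^7 - 3*x^6 + 12*x^5 - 6*x^3 - 6*x^2 + 3*x - 3)`,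
`h = 1`, `3𝓞 = 𝔭⁸`; PARI j307532/j307547). KERNEL: elliptic, minimal, `ClassO6 E 3`, `E[3]` irreducible, image `= C_ns⁺(3)`, `c² = 1`,
`c ≠ ±1`. Per row; nothing booked; BSD proved for no curve. [cite: Kato2004Asterisque, Thm. 14.5 (3) (p. 236)]
[cite: Greenberg2001IwasawaPastPresent, Prop. 2.1 p. 339] [cite: CoatesSujatha2005, Thm. 3.4 (§3)] [cite: Cremona2006, Table 1 (Cremona label 443205bc1)] -/
theorem missingUpperBoundAt_g443205bc1_3_iw
    (hKatoA : Kato2004.rankZero_padicValNat_sha_add_padicValNat_tamagawa_le_of_additive_potGood_of_irreducible_of_fineSelmerDual_fg)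
    (hGZK : rank_eq_analyticRank_of_analyticRank_le_one) (hmod : hasEntireLFunction_rat)
    (hCS : CoatesSujatha2005.thm34_fineSelmerDual_moduleFinite_of_classicalMuVanishes_divisionField)
    (hI : iwasawa1959_classNumberPExp_growth) (hFW : ferreroWashington1979_classicalMuVanishes)
    (hIw : iwasawa1956_classNumberPExp_eq_zero_of_not_dvd_classNumber_of_unique_prime)
    {W : WeierstrassCurve ℚ} [W.IsElliptic] [W.IsGloballyMinimal] (hWeq : W = (⟨1, (-1), 0, (-1601574), (-822843757)⟩ : WeierstrassCurve ℚ)) (hr : W.analyticRank = 0)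
    {c : absoluteGaloisGroup ℚ} (hc : IsComplexConjugation (Rat.castHom ℝ) c)
    (hh : haveI : NumberField ↥(W.divisionField 3) := NumberField.mk
      ¬ 3 ∣ NumberField.classNumber ↥(fixedField (Subgroup.zpowers (absRestrictNormalHom (W.divisionField 3) c))))
    (hv : haveI : NumberField ↥(W.divisionField 3) := NumberField.mk
      ∃! v : IsDedekindDomain.HeightOneSpectrum (𝓞 ↥(fixedField (Subgroup.zpowers (absRestrictNormalHom (W.divisionField 3) c)))),
        ((3 : ℕ) : 𝓞 ↥(fixedField (Subgroup.zpowers (absRestrictNormalHom (W.divisionField 3) c)))) ∈ v.asIdeal) :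
    MissingUpperBoundAt W 3 := by
  subst hWeq
  exact CartanMuRoadRealDoors.missingUpperBoundAt_three_of_hasModPImageEqNonsplitCartanNormalizer_of_realClassNumber _ hKatoA hGZK hmod
    hCS hI hFW hIw hr classO6_g443205bc1_3 irr_g443205bc1_3 hasModPImageEqNonsplitCartanNormalizer_g443205bc1_3 hc hh hv

/-! ### `487350gz1` — `K⁺ = ℚ(E[3])⁺ ≅ ℚ[x]/(x^8 - 2*x^7 - 17*x^6 - 44*x^5 + 355*x^4 + 346*x^3 - 2372*x^2 - 872*x + 5536)` (degree 8, disc -1607645964796875), `h(K⁺) = 4`, `3𝓞 = 𝔭⁸` (PARI/GP 2.17, kit j307532; `bnfcertify` j307547) -/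

/-- **(A) AT `(487350gz1, 3)` FROM NAMED FACTS + TWO NUMERICAL FACTS ABOUT `K⁺ = ℚ(E[3])⁺`** (Iwasawa's 1956 criterion): image `3Nn` in the
kernel (`hasModPImageEqNonsplitCartanNormalizer_g487350gz1_3`); named facts Coates–Sujatha Thm. 3.4 (`hCS`), Iwasawa growth (`hI`), Ferrero–Washington
(`hFW`), Iwasawa 1956 (`hIw`); DISPLAYED: `3 ∤ h(K⁺)` (`hh`) and «exactly one prime of `K⁺` above `3`» (`hv`) for the maximal real subfield
`K⁺` of `ℚ(E[3])` (the fixed field of a complex conjugation `c`) — numerically `K⁺ ≅ ℚ[x]/(x^8 - 2*x^7 - 17*x^6 - 44*x^5 + 355*x^4 + 346*x^3 - 2372*x^2 - 872*x + 5536)`, `h = 4`, `3` totally ramified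
(PARI, kit j307532 / j307547; the identification `K⁺ = ℚ(P)`, `P` a real `3`-torsion point, is this seat's memo §5, not a kernel statement).
CONDITIONAL; nothing booked; (A)/BSD proved for no curve. [cite: Greenberg2001IwasawaPastPresent, Prop. 2.1 p. 339] [cite: CoatesSujatha2005, Thm. 3.4 (§3)]
[cite: Serre1972, §2.2, §5.2 (iv)] [cite: Cremona2006, Table 1 (Cremona label 487350gz1)] -/
theorem conjA_g487350gz1_3_iw
    (hCS : CoatesSujatha2005.thm34_fineSelmerDual_moduleFinite_of_classicalMuVanishes_divisionField)
    (hI : iwasawa1959_classNumberPExp_growth) (hFW : ferreroWashington1979_classicalMuVanishes)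
    (hIw : iwasawa1956_classNumberPExp_eq_zero_of_not_dvd_classNumber_of_unique_prime)
    {W : WeierstrassCurve ℚ} [W.IsElliptic] (hWeq : W = (⟨1, (-1), 1, 70894195, 254604566197⟩ : WeierstrassCurve ℚ))
    {c : absoluteGaloisGroup ℚ} (hc : IsComplexConjugation (Rat.castHom ℝ) c)
    (hh : haveI : NumberField ↥(W.divisionField 3) := NumberField.mk
      ¬ 3 ∣ NumberField.classNumber ↥(fixedField (Subgroup.zpowers (absRestrictNormalHom (W.divisionField 3) c))))
    (hv : haveI : NumberField ↥(W.divisionField 3) := NumberField.mk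
      ∃! v : IsDedekindDomain.HeightOneSpectrum (𝓞 ↥(fixedField (Subgroup.zpowers (absRestrictNormalHom (W.divisionField 3) c)))),
        ((3 : ℕ) : 𝓞 ↥(fixedField (Subgroup.zpowers (absRestrictNormalHom (W.divisionField 3) c)))) ∈ v.asIdeal)
    (κ : ZpExtension ℚ 3) (hκ : κ.IsCyclotomic) :
    ∃ (γ : absoluteGaloisGroup ℚ) (Df : W.FineSelmerDualData κ γ),
      Module.Finite ℤ_[3] (RestrictScalars ℤ_[3] (IwasawaAlgebra 3) Df.X) := by
  subst hWeq
  exact CartanMuRoadRealDoors.conjA_three_of_hasModPImageEqNonsplitCartanNormalizer_of_realClassNumber _ hCS hI hFW hIw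
    hasModPImageEqNonsplitCartanNormalizer_g487350gz1_3 hc hh hv κ hκ

/-- **RECORD — U₀ `ord₃ #Ш(E) ≤ ord₃ #Ш_an(E)` for `E = 487350gz1` FROM NAMED FACTS + Cremona's `r_an = 0` + TWO NUMERICAL FACTS ABOUT `K⁺`**:
named facts `hKatoA hGZK hmod hCS hI hFW hIw`; DISPLAYED: `hr`, `hh : 3 ∤ h(K⁺)`, `hv : one prime of K⁺ above 3` (`K⁺ ≅ ℚ[x]/(x^8 - 2*x^7 - 17*x^6 - 44*x^5 + 355*x^4 + 346*x^3 - 2372*x^2 - 872*x + 5536)`,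
`h = 4`, `3𝓞 = 𝔭⁸`; PARI j307532/j307547). KERNEL: elliptic, minimal, `ClassO6 E 3`, `E[3]` irreducible, image `= C_ns⁺(3)`, `c² = 1`,
`c ≠ ±1`. Per row; nothing booked; BSD proved for no curve. [cite: Kato2004Asterisque, Thm. 14.5 (3) (p. 236)]
[cite: Greenberg2001IwasawaPastPresent, Prop. 2.1 p. 339] [cite: CoatesSujatha2005, Thm. 3.4 (§3)] [cite: Cremona2006, Table 1 (Cremona label 487350gz1)] -/
theorem missingUpperBoundAt_g487350gz1_3_iw
    (hKatoA : Kato2004.rankZero_padicValNat_sha_add_padicValNat_tamagawa_le_of_additive_potGood_of_irreducible_of_fineSelmerDual_fg)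
    (hGZK : rank_eq_analyticRank_of_analyticRank_le_one) (hmod : hasEntireLFunction_rat)
    (hCS : CoatesSujatha2005.thm34_fineSelmerDual_moduleFinite_of_classicalMuVanishes_divisionField)
    (hI : iwasawa1959_classNumberPExp_growth) (hFW : ferreroWashington1979_classicalMuVanishes)
    (hIw : iwasawa1956_classNumberPExp_eq_zero_of_not_dvd_classNumber_of_unique_prime)
    {W : WeierstrassCurve ℚ} [W.IsElliptic] [W.IsGloballyMinimal] (hWeq : W = (⟨1, (-1), 1, 70894195, 254604566197⟩ : WeierstrassCurve ℚ)) (hr : W.analyticRank = 0)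
    {c : absoluteGaloisGroup ℚ} (hc : IsComplexConjugation (Rat.castHom ℝ) c)
    (hh : haveI : NumberField ↥(W.divisionField 3) := NumberField.mk
      ¬ 3 ∣ NumberField.classNumber ↥(fixedField (Subgroup.zpowers (absRestrictNormalHom (W.divisionField 3) c))))
    (hv : haveI : NumberField ↥(W.divisionField 3) := NumberField.mk
      ∃! v : IsDedekindDomain.HeightOneSpectrum (𝓞 ↥(fixedField (Subgroup.zpowers (absRestrictNormalHom (W.divisionField 3) c)))),
        ((3 : ℕ) : 𝓞 ↥(fixedField (Subgroup.zpowers (absRestrictNormalHom (W.divisionField 3) c)))) ∈ v.asIdeal) :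
    MissingUpperBoundAt W 3 := by
  subst hWeq
  exact CartanMuRoadRealDoors.missingUpperBoundAt_three_of_hasModPImageEqNonsplitCartanNormalizer_of_realClassNumber _ hKatoA hGZK hmod
    hCS hI hFW hIw hr classO6_g487350gz1_3 irr_g487350gz1_3 hasModPImageEqNonsplitCartanNormalizer_g487350gz1_3 hc hh hv

end Summit.BirchSwinnertonDyer.BirchSwinnertonDyer.Theorems.WildUpperUnitTwistRecords

end
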